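import Mathlib.Algebra.QuadraticAlgebra.Basic
import Mathlib.LinearAlgebra.Matrix.ConjTranspose
import Mathlib.LinearAlgebra.Matrix.Notation
import Mathlib.LinearAlgebra.Matrix.Determinant.Basic
import Mathlib.Data.ZMod.Basic
import Mathlib.Tactic.Ring
import Mathlib.Tactic.LinearCombination
import Mathlib.Tactic.Linarith
import Literature.NumberTheory.NumberFields.EisensteinFieldIntegers
import HarnessLib

/-!
# Venture HSemireg — π-glued products `G(a′,c′) = [[a′+c′, c′π̄],[c′π, 3c′]]` over `ℤ[ω]` (ENGINE-W PROBE5 §37 THEOREM 37-C)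
# and the `[[2,1],[1,2]]` arithmetic of THEOREM 30-B — kernel algebra

HONEST FRAMING. Lean index of the computation cell `pub-hsemireg`, widening group ENGINE-W (code A, seat `engine-w-1`,
gen 17). INTEGER ∕ `ℤ[ω]` ARITHMETIC and two `2 × 2` matrix identities; `ℤ[ω] = QuadraticAlgebra ℤ (−1) (−1)` (`ω² = −1 − ω`,
`star` = complex conjugation, the cell's model as in `AntilinearInvolutionKinds.lean`); no abelian variety, sheaf, `Ext` group,
secant structure or semiregularity map is constructed; nothing here says that HC, HC_CM or HC_AV holds. Theorems only
(0 `def`, 0 named fact, 0 `sorry`); the Eisenstein norm lemma `Literature.NumberTheory.NumberFields.K3.norm_int_eq_zero_iff`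
is REUSED, not re-declared. New namespace `PiGlued`.

SOURCE (the cell's own result): `widen/ENGINE-W/out/probe5/PROBE5-STIZ-A.md` §37 (v4.3, engine-w-1 g11) **THEOREM 37-C** as
printed: «(π-GLUED PRODUCTS ARE NEVER REACHED — every imaginary node field `m < 0`, `m ≠ −3`, every integral oriented target).
Let `(L, H)` have a unitary automorphism `g` of order `3` with distinct eigenvalues whose eigenlattices … do NOT span `L`. Then
`L = O_Kv₁ ⊕ O_Kv₂ + O_K·π⁻¹(v₁ + v₂)` with `H(v₁) = 3a′`, `H(v₂) = 3c′` …, i.e. **`H ≅ G(a′,c′) := [[a′ + c′, c′π̄],[c′π, 3c′]]`,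
`det 3a′c′`** … PROOF … the seed `R₀²` has unitary group the MONOMIAL group `μ(F) ≀ S₂` …, whose elements of order `3` are
all DIAGONAL (an anti-diagonal `[[0,u],[v,0]]` has cube `uv·[[0,u],[v,0]] ≠ I`) … INSTANCES: `G(1,1) = [[2, π̄],[π, 3]] ≅
[[2,1],[1,2]]` — THEOREM 30-A is the case `a′ = c′ = 1`; `G(1,2) ≅ [[3,√−3],[−√−3,3]]` (`d` 6)», and §30 (v3.6) THEOREM 30-A (3)
∕ THEOREM 30-B (4): «`H212[v] = |v₁|² + |v₂|² + |v₁+v₂|² ≥ 2` (`v ≠ 0`)», «(ii) `c = (π)`: `Hv ≡ 0 (π) ⟺ v₂ ≡ v₁ (π) ⟹ H[v] ≡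
6|v₁|² ≡ 0 (3)`», «(iii) … `H[v] = 3 ⟺ v ∈ O_K^×·{(1,ω),(1,ω̄)}`, whose `Hv` has content `(π)`», «so `H[v]² = N(c(v)) ∈ {1, 3, 9}`:
`(H[v], c(v)) = (1,(1))` or `(3,(3))`, both impossible for `H212`». What the kernel holds (`π = 1 − ω = ⟨1,−1⟩`, `π̄ = ⟨2,1⟩`,
`√−3 = 1 + 2ω = ⟨1,2⟩`, norm `N(a + bω) = a² − ab + b²`):

* §1 (any ring) **`antidiagonal_cube`** `[[0,u],[v,0]]³ = [[0, uvu],[vuv, 0]]` and `antidiagonal_cube_ne_one` (nontrivial ring):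
  the order-3 elements of a monomial group `μ ≀ S₂` are diagonal.
* §2 (`ℤ[ω]`) `pi_mul_star_pi` (`ππ̄ = 3`), **`piGlued_det`** (`det G(a′,c′) = 3a′c′`), **`G11_congr_H212`** (`P·G(1,1)·Pᴴ =
  [[2,1],[1,2]]` for the explicit `P = [[ω², ω],[−1, 0]]`, `det P = ω` a unit: `G11_congr_det`), **`G12_congr`** (`Q·G(1,2)·Qᴴ =
  [[3, √−3],[−√−3, 3]]`, `Q = [[−2−ω, 1+ω],[ω, −ω]]`, `det Q = ω`).
* §3 (`ℤ⁴`, `v = (v₁, v₂)`, `v_i = a_i + b_iω`) `h212_ge_two` (`H212[v] ≥ 2` for `v ≠ 0`, hence `h212_ne_one`), **`h212_dvd_three`**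
  (`v₂ ≡ v₁ (mod π)`, i.e. `3 ∣ (a₂ + b₂) − (a₁ + b₁)`, ⟹ `3 ∣ H212[v]`), **`h212_eq_three`** (`H212[v] = 3 ⟹ |v₁|² = |v₂|² =
  |v₁+v₂|² = 1`) and `h212_eq_three_content` (then `|2v₁ + v₂|² = |v₁ + 2v₂|² = 3`: the two coordinates of `H212·v` have norm
  `3`, content `(π)` not `(3)`), `sq_eq_content_norm` (`H² = n`, `n ∈ {1,3,9}` ⟹ `(H,n) = (1,1)` or `(3,9)`).
WHAT IS NOT HERE: lattices, eigenlattices, the unitary group of the seed, THEOREM 37-C ∕ 30-B as lattice statements.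
-/

namespace Summit.Ventures.HSemireg.PiGlued

open Matrix QuadraticAlgebra

/-! ## §1 Anti-diagonal elements of a monomial group never have order 3 -/

/-- «an anti-diagonal `[[0,u],[v,0]]` has cube `uv·[[0,u],[v,0]]`»: over any ring,
`[[0,u],[v,0]]³ = [[0, u·v·u],[v·u·v, 0]]` — again ANTI-diagonal. [kernel] -/
theorem antidiagonal_cube {R : Type*} [Ring R] (u v : R) :
    (!![0, u; v, 0] : Matrix (Fin 2) (Fin 2) R) ^ 3 = !![0, u * v * u; v * u * v, 0] := by
  rw [pow_succ, pow_two]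
  ext i j
  fin_cases i <;> fin_cases j <;> simp [Matrix.mul_apply, Fin.sum_univ_two, mul_assoc]

/-- Hence `[[0,u],[v,0]]³ ≠ 1` in a nontrivial ring: NO anti-diagonal element of `μ(F) ≀ S₂` has order `3` — «whose elements of
order `3` are all DIAGONAL … and therefore split `R₀² = R₀e₁ ⊕ R₀e₂`». [kernel] -/
theorem antidiagonal_cube_ne_one {R : Type*} [Ring R] [Nontrivial R] (u v : R) :
    (!![0, u; v, 0] : Matrix (Fin 2) (Fin 2) R) ^ 3 ≠ 1 := by
  rw [antidiagonal_cube]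
  intro h
  have h00 := congrFun (congrFun h 0) 0
  simp at h00

/-! ## §2 The π-glued Gram matrix over `ℤ[ω] = QuadraticAlgebra ℤ (−1) (−1)` -/

/-- `π·π̄ = 3` for `π = 1 − ω = ⟨1, −1⟩` (`π̄ = ⟨2, 1⟩ = 2 + ω`). [kernel] -/
theorem pi_mul_star_pi : (⟨1, -1⟩ : QuadraticAlgebra ℤ (-1) (-1)) * star ⟨1, -1⟩ = 3 := by
  ext <;> simp [star_mk]

/-- `π̄ = 2 + ω` in coordinates. [kernel] -/
theorem star_pi : star (⟨1, -1⟩ : QuadraticAlgebra ℤ (-1) (-1)) = ⟨2, 1⟩ := by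
  ext <;> simp [star_mk]

/-- **`det G(a′,c′) = 3a′c′`**: `(a′ + c′)·3c′ − (c′π̄)(c′π) = 3a′c′` in `ℤ[ω]` («`H ≅ G(a′,c′) := [[a′ + c′, c′π̄],[c′π, 3c′]]`,
det `3a′c′`»). [kernel] -/
theorem piGlued_det (a' c' : ℤ) :
    Matrix.det !![((a' + c' : ℤ) : QuadraticAlgebra ℤ (-1) (-1)), (c' : QuadraticAlgebra ℤ (-1) (-1)) * ⟨2, 1⟩;
        (c' : QuadraticAlgebra ℤ (-1) (-1)) * ⟨1, -1⟩, ((3 * c' : ℤ) : QuadraticAlgebra ℤ (-1) (-1))]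
      = ((3 * a' * c' : ℤ) : QuadraticAlgebra ℤ (-1) (-1)) := by
  rw [Matrix.det_fin_two_of]
  ext <;> simp <;> ring

/-- **`G(1,1) ≅ [[2,1],[1,2]]`** («THEOREM 30-A is the case `a′ = c′ = 1`»): with `P = [[ω², ω],[−1, 0]]` (rows = the new basis
`b₁ = ω²e₁ + ωe₂`, `b₂ = −e₁` in terms of `(e₁, e₂) = (π⁻¹(v₁+v₂), v₂)`), `P·G(1,1)·Pᴴ = [[2,1],[1,2]]`. [kernel] -/
theorem G11_congr_H212 :
    (!![ω * ω, ω; -1, 0] : Matrix (Fin 2) (Fin 2) (QuadraticAlgebra ℤ (-1) (-1)))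
        * !![2, ⟨2, 1⟩; ⟨1, -1⟩, 3] * (!![ω * ω, ω; -1, 0])ᴴ = !![2, 1; 1, 2] := by
  apply Matrix.ext
  intro i j
  fin_cases i <;> fin_cases j <;>
    (simp [Matrix.mul_apply, Fin.sum_univ_two, Matrix.conjTranspose_apply, star_mk, omega]; try (ext <;> simp))

/-- … and `det P = ω`, a unit (`ω·ω² = 1`), so `P ∈ GL₂(ℤ[ω])`. [kernel] -/
theorem G11_congr_det :
    Matrix.det (!![ω * ω, ω; -1, 0] : Matrix (Fin 2) (Fin 2) (QuadraticAlgebra ℤ (-1) (-1))) = ω ∧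
      (ω : QuadraticAlgebra ℤ (-1) (-1)) * (ω * ω) = 1 := by
  refine ⟨?_, ?_⟩
  · rw [Matrix.det_fin_two_of]; ext <;> simp [omega]
  · ext <;> simp [omega]

/-- **`G(1,2) ≅ [[3, √−3],[−√−3, 3]]`** (`d = 6`; `√−3 = 1 + 2ω = ⟨1,2⟩`): with `Q = [[−2−ω, 1+ω],[ω, −ω]]`,
`Q·G(1,2)·Qᴴ = [[3, √−3],[−√−3, 3]]` where `G(1,2) = [[3, 2π̄],[2π, 6]]`; `det Q = ω`. [kernel] -/
theorem G12_congr :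
    (!![⟨-2, -1⟩, ⟨1, 1⟩; ω, -ω] : Matrix (Fin 2) (Fin 2) (QuadraticAlgebra ℤ (-1) (-1)))
        * !![3, ⟨4, 2⟩; ⟨2, -2⟩, 6] * (!![⟨-2, -1⟩, ⟨1, 1⟩; ω, -ω])ᴴ = !![3, ⟨1, 2⟩; -⟨1, 2⟩, 3] ∧
      Matrix.det (!![⟨-2, -1⟩, ⟨1, 1⟩; ω, -ω] : Matrix (Fin 2) (Fin 2) (QuadraticAlgebra ℤ (-1) (-1))) = ω := by
  refine ⟨?_, ?_⟩
  · apply Matrix.ext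
    intro i j
    fin_cases i <;> fin_cases j <;>
      (simp [Matrix.mul_apply, Fin.sum_univ_two, Matrix.conjTranspose_apply, star_mk, omega];
        try (ext <;> simp))
  · rw [Matrix.det_fin_two_of]; ext <;> simp [omega]

/-! ## §3 The `[[2,1],[1,2]]` arithmetic over `ℤ[ω]` (THEOREM 30-A (3), THEOREM 30-B (4)) -/

/-- **`H212[v] ≥ 2` for `v ≠ 0`** («`H212[v] = |v₁|² + |v₂|² + |v₁+v₂|² ≥ 2` (`v ≠ 0`)»; `v₁ = a + bω`, `v₂ = c + dω`): of the three
norms at most one can vanish. [kernel] -/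
theorem h212_ge_two (a b c d : ℤ) (hv : ¬ (a = 0 ∧ b = 0 ∧ c = 0 ∧ d = 0)) :
    2 ≤ (a ^ 2 - a * b + b ^ 2) + (c ^ 2 - c * d + d ^ 2) + ((a + c) ^ 2 - (a + c) * (b + d) + (b + d) ^ 2) := by
  have n1 : 0 ≤ a ^ 2 - a * b + b ^ 2 := by nlinarith [sq_nonneg (2 * a - b), sq_nonneg b]
  have n2 : 0 ≤ c ^ 2 - c * d + d ^ 2 := by nlinarith [sq_nonneg (2 * c - d), sq_nonneg d]
  have n3 : 0 ≤ (a + c) ^ 2 - (a + c) * (b + d) + (b + d) ^ 2 := by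
    nlinarith [sq_nonneg (2 * (a + c) - (b + d)), sq_nonneg (b + d)]
  have z1 := Literature.NumberTheory.NumberFields.K3.norm_int_eq_zero_iff a b
  have z2 := Literature.NumberTheory.NumberFields.K3.norm_int_eq_zero_iff c d
  have z3 := Literature.NumberTheory.NumberFields.K3.norm_int_eq_zero_iff (a + c) (b + d)
  by_contra hlt
  -- the three norms sum to ≤ 1, so at least two of them vanish, forcing v = 0
  have two : (a ^ 2 - a * b + b ^ 2 = 0 ∧ c ^ 2 - c * d + d ^ 2 = 0)
      ∨ (a ^ 2 - a * b + b ^ 2 = 0 ∧ (a + c) ^ 2 - (a + c) * (b + d) + (b + d) ^ 2 = 0)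
      ∨ (c ^ 2 - c * d + d ^ 2 = 0 ∧ (a + c) ^ 2 - (a + c) * (b + d) + (b + d) ^ 2 = 0) := by
    omega
  rcases two with ⟨h1, h2⟩ | ⟨h1, h3⟩ | ⟨h2, h3⟩
  · obtain ⟨rfl, rfl⟩ := z1.1 h1
    obtain ⟨rfl, rfl⟩ := z2.1 h2
    exact hv ⟨rfl, rfl, rfl, rfl⟩
  · obtain ⟨rfl, rfl⟩ := z1.1 h1
    obtain ⟨hc, hd⟩ := z3.1 h3
    simp only [zero_add] at hc hd
    exact hv ⟨rfl, rfl, hc, hd⟩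
  · obtain ⟨rfl, rfl⟩ := z2.1 h2
    obtain ⟨ha, hb⟩ := z3.1 h3
    simp only [add_zero] at ha hb
    exact hv ⟨ha, hb, rfl, rfl⟩

/-- Hence `[[2,1],[1,2]]` does not represent `1` over `ℤ[ω]` (the case `(H[v], c(v)) = (1,(1))` of 30-B is impossible). [kernel] -/
theorem h212_ne_one (a b c d : ℤ) :
    (a ^ 2 - a * b + b ^ 2) + (c ^ 2 - c * d + d ^ 2) + ((a + c) ^ 2 - (a + c) * (b + d) + (b + d) ^ 2) ≠ 1 := by
  by_cases hv : a = 0 ∧ b = 0 ∧ c = 0 ∧ d = 0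
  · obtain ⟨rfl, rfl, rfl, rfl⟩ := hv; simp
  · have := h212_ge_two a b c d hv; omega

/-- **(ii) `v₂ ≡ v₁ (mod π) ⟹ 3 ∣ H212[v]`** («`Hv ≡ 0 (π) ⟺ v₂ ≡ v₁ (π) ⟹ H[v] ≡ 6|v₁|² ≡ 0 (3)`»; `π ∣ x + yω ⟺ 3 ∣ x + y`,
cf. `Literature…K3.lamInt_dvd_mkInt_iff`). [kernel, via `ZMod 3`] -/
theorem h212_dvd_three (a b c d : ℤ) (h : (3 : ℤ) ∣ (c + d) - (a + b)) :
    (3 : ℤ) ∣ (a ^ 2 - a * b + b ^ 2) + (c ^ 2 - c * d + d ^ 2) + ((a + c) ^ 2 - (a + c) * (b + d) + (b + d) ^ 2) := by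
  have key : ∀ x y z w : ZMod 3, z + w - (x + y) = 0 →
      (x ^ 2 - x * y + y ^ 2) + (z ^ 2 - z * w + w ^ 2) + ((x + z) ^ 2 - (x + z) * (y + w) + (y + w) ^ 2) = 0 := by
    decide
  have h3 := (ZMod.intCast_zmod_eq_zero_iff_dvd _ 3).2 h
  push_cast at h3
  have := key _ _ _ _ h3
  have h4 := (ZMod.intCast_zmod_eq_zero_iff_dvd
    ((a ^ 2 - a * b + b ^ 2) + (c ^ 2 - c * d + d ^ 2) + ((a + c) ^ 2 - (a + c) * (b + d) + (b + d) ^ 2)) 3).1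
  apply h4
  push_cast
  exact this

/-- **(iii) `H212[v] = 3 ⟹ |v₁|² = |v₂|² = |v₁ + v₂|² = 1`** (so `v₁` is a unit and `v₂ ∈ {ωv₁, ω̄v₁}`: «`H[v] = 3 ⟺ v ∈
O_K^×·{(1,ω),(1,ω̄)}`»): a vanishing norm would make the sum of the other two EVEN. [kernel] -/
theorem h212_eq_three (a b c d : ℤ)
    (h : (a ^ 2 - a * b + b ^ 2) + (c ^ 2 - c * d + d ^ 2) + ((a + c) ^ 2 - (a + c) * (b + d) + (b + d) ^ 2) = 3) :
    a ^ 2 - a * b + b ^ 2 = 1 ∧ c ^ 2 - c * d + d ^ 2 = 1 ∧ (a + c) ^ 2 - (a + c) * (b + d) + (b + d) ^ 2 = 1 := by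
  have n1 : 0 ≤ a ^ 2 - a * b + b ^ 2 := by nlinarith [sq_nonneg (2 * a - b), sq_nonneg b]
  have n2 : 0 ≤ c ^ 2 - c * d + d ^ 2 := by nlinarith [sq_nonneg (2 * c - d), sq_nonneg d]
  have n3 : 0 ≤ (a + c) ^ 2 - (a + c) * (b + d) + (b + d) ^ 2 := by
    nlinarith [sq_nonneg (2 * (a + c) - (b + d)), sq_nonneg (b + d)]
  have z1 := Literature.NumberTheory.NumberFields.K3.norm_int_eq_zero_iff a b
  have z2 := Literature.NumberTheory.NumberFields.K3.norm_int_eq_zero_iff c d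
  have z3 := Literature.NumberTheory.NumberFields.K3.norm_int_eq_zero_iff (a + c) (b + d)
  -- if one norm vanishes, the corresponding vector relation makes the remaining two norms equal, sum 3 = 2·N: parity
  rcases Int.le_iff_eq_or_lt.1 n1 with h1 | h1
  · obtain ⟨rfl, rfl⟩ := z1.1 h1.symm; simp at h; omega
  rcases Int.le_iff_eq_or_lt.1 n2 with h2 | h2
  · obtain ⟨rfl, rfl⟩ := z2.1 h2.symm; simp at h; omega
  rcases Int.le_iff_eq_or_lt.1 n3 with h3 | h3
  · obtain ⟨hc, hd⟩ := z3.1 h3.symm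
    have hc' : c = -a := by omega
    have hd' : d = -b := by omega
    subst hc' hd'
    have : a ^ 2 - a * b + b ^ 2 = (-a) ^ 2 - (-a) * (-b) + (-b) ^ 2 := by ring
    omega
  omega

/-- … and then the two coordinates of `H212·v = (2v₁ + v₂, v₁ + 2v₂)` have norm `3` each: `|2v₁ + v₂|² = 2|v₁|² − |v₂|² + 2|v₁+v₂|²
= 3`, `|v₁ + 2v₂|² = −|v₁|² + 2|v₂|² + 2|v₁+v₂|² = 3` — so `c(v) = (π)` («whose `Hv` has content `(π)`»), NOT `(3)` (norm `9`):
the case `(H[v], c(v)) = (3,(3))` of 30-B is impossible. [kernel] -/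
theorem h212_eq_three_content (a b c d : ℤ)
    (h : (a ^ 2 - a * b + b ^ 2) + (c ^ 2 - c * d + d ^ 2) + ((a + c) ^ 2 - (a + c) * (b + d) + (b + d) ^ 2) = 3) :
    (2 * a + c) ^ 2 - (2 * a + c) * (2 * b + d) + (2 * b + d) ^ 2 = 3 ∧
      (a + 2 * c) ^ 2 - (a + 2 * c) * (b + 2 * d) + (b + 2 * d) ^ 2 = 3 := by
  obtain ⟨h1, h2, h3⟩ := h212_eq_three a b c d h
  constructor <;> nlinarith [h1, h2, h3]

/-- 30-B's count «`H[v]² = N(c(v)) ∈ {1, 3, 9}`: `(H[v], c(v)) = (1,(1))` or `(3,(3))`»: a non-negative integer whose square is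
`1`, `3` or `9` is `1` (square `1`) or `3` (square `9`). [kernel] -/
theorem sq_eq_content_norm (H n : ℤ) (hH : 0 ≤ H) (hsq : H ^ 2 = n) (hn : n = 1 ∨ n = 3 ∨ n = 9) :
    (H = 1 ∧ n = 1) ∨ (H = 3 ∧ n = 9) := by
  have hH3 : H ≤ 3 := by rcases hn with rfl | rfl | rfl <;> nlinarith
  interval_cases H <;> omega

end Summit.Ventures.HSemireg.PiGlued
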